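import Summits.Ventures.PercRepro.C025ProfilePLDUniformTable_r5_s6_m11
import Summits.Ventures.PercRepro.C025ProfilePLDSixLiftArithB
import Summits.Ventures.PercRepro.C025ProfilePLDSixTable5a
import Summits.Ventures.PercRepro.C025ProfilePLDSixTable5b
import Summits.Ventures.PercRepro.C025ProfilePLDSixTable5c
import Summits.Ventures.PercRepro.C025ProfilePLDSixTable5d

/-!
# (PLD) FOR «M ⊕ U_{6,m}» FOR EVERY m ≥ 11 AND EVERY (PLD)-MATROID M OF RANK ≤ 5: THE CERTIFICATE TABLE FOR U_{6,11} LIFTED IN m (night-3 g33)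

`proofs/NIGHT3-G33-RANKEIGHT.md` §6.  The profile of `U_{6,m}` is `T₀₆ + m·T₁₆ + C(m,2)·T₂₆ + C(m,3)·T₃₆ + C(m,4)·T₄₆ + C(m,5)·T₅₆ + c_m·δ₆₆`
(`PLDSixLift.sum_choose_min_six`, `m ≥ 11`); `T₅₆` and `δ₆₆` preserve PER-LAYER DOMINANCE (g29), the joint-LP preservers
`q₆ = T₁₆ + 3·T₂₆ + 6·T₃₆ + 9·T₄₆ + 11·T₅₆`, `q₆′ = T₂₆ + 2·T₃₆ + 3·T₄₆ + 4·T₅₆`, `q₆″ = T₃₆ + 2·T₄₆ + 3·T₅₆`, `q₆‴ = T₄₆ + 2·T₅₆` do at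
rank ≤ 5 (`PLDPlaneTable.pld_conv_q61_of_eRank_le_5`, …, `pld_conv_q64_of_eRank_le_5`), and
`120·(U_{6,11+k} − U_{6,11}) = 120k·q₆ + 60k(15+k)·q₆′ + 20k(173+24k+k²)·q₆″ + 5k(1242+311k+30k²+k³)·q₆‴ + k(3874+2365k+445k²+35k³+k⁴)·T₅₆ + 120(c_{11+k} − c₁₁)·δ₆₆`
(`lift_instance_six_three`): ONE certificate table — the landed `uniform_6_11_table_5` for `M ⊕ U_{6,11}` at rank ≤ 5 — gives (PLD) for
`M ⊕ U_{6,m}` for EVERY `m ≥ 11` (`pld_disjointSum_uniform_six_ge_11_of_eRank_le_5`).  No `def`, no `instance`, no notation.  Axioms: standard.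
-/

open scoped Matroid

namespace PercRepro

open Finset ThmH

namespace PLDSixLift

variable {α : Type} [DecidableEq α]

/-- (PLD) FOR «M ⊕ U_{6,m}» FOR EVERY `m ≥ 11` AND EVERY (PLD)-MATROID `M` OF RANK ≤ 5: the uniform matroid is
`truncate (freeOn F) 6` with `|F| = m ≥ 11`. -/
theorem pld_disjointSum_uniform_six_ge_11_of_eRank_le_5 (M : Matroid α) [M.Finite] (hr : M.eRank ≤ 5)
    (hPLD : ∀ lo hi δ Θ : ℕ, Θ ≤ lo + hi + δ → (lo = 0 ∨ lo + hi + δ ≤ Θ) →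
      (∑ I ∈ (gr M).powerset, (if lo ≤ (M.eRk (I : Set α)).toNat ∧ (M.eRk (I : Set α)).toNat ≤ hi ∧
          Θ ≤ (M.eRk ((gr M \ I : Finset α) : Set α)).toNat + (M.eRk (I : Set α)).toNat then
          ((M.eRk ((gr M \ I : Finset α) : Set α)).toNat).choose δ else 0)) ≤
        ∑ I ∈ (gr M).powerset, (if lo + δ ≤ (M.eRk ((gr M \ I : Finset α) : Set α)).toNat ∧
          (M.eRk ((gr M \ I : Finset α) : Set α)).toNat ≤ hi + δ then
          ((M.eRk ((gr M \ I : Finset α) : Set α)).toNat).choose δ else 0))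
    (F : Finset α) (hF : 11 ≤ F.card)
    (h : Disjoint M.E (@Matroid.truncate α (Matroid.freeOn (F : Set α)) (PLDTruncate.freeOn_finite' F) 6).E) :
    haveI := PLDTruncate.freeOn_finite' F
    haveI := PLDClosure.disjointSum_finite' _ _ h
    ∀ lo hi δ Θ : ℕ, Θ ≤ lo + hi + δ → (lo = 0 ∨ lo + hi + δ ≤ Θ) →
      (∑ I ∈ (gr (M.disjointSum (Matroid.truncate (Matroid.freeOn (F : Set α)) 6) h)).powerset, (if lo ≤ ((M.disjointSum (Matroid.truncate (Matroid.freeOn (F : Set α)) 6) h).eRk (I : Set α)).toNat ∧ ((M.disjointSum (Matroid.truncate (Matroid.freeOn (F : Set α)) 6) h).eRk (I : Set α)).toNat ≤ hi ∧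
          Θ ≤ ((M.disjointSum (Matroid.truncate (Matroid.freeOn (F : Set α)) 6) h).eRk ((gr (M.disjointSum (Matroid.truncate (Matroid.freeOn (F : Set α)) 6) h) \ I : Finset α) : Set α)).toNat + ((M.disjointSum (Matroid.truncate (Matroid.freeOn (F : Set α)) 6) h).eRk (I : Set α)).toNat then
          (((M.disjointSum (Matroid.truncate (Matroid.freeOn (F : Set α)) 6) h).eRk ((gr (M.disjointSum (Matroid.truncate (Matroid.freeOn (F : Set α)) 6) h) \ I : Finset α) : Set α)).toNat).choose δ else 0)) ≤
        ∑ I ∈ (gr (M.disjointSum (Matroid.truncate (Matroid.freeOn (F : Set α)) 6) h)).powerset, (if lo + δ ≤ ((M.disjointSum (Matroid.truncate (Matroid.freeOn (F : Set α)) 6) h).eRk ((gr (M.disjointSum (Matroid.truncate (Matroid.freeOn (F : Set α)) 6) h) \ I : Finset α) : Set α)).toNat ∧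
          ((M.disjointSum (Matroid.truncate (Matroid.freeOn (F : Set α)) 6) h).eRk ((gr (M.disjointSum (Matroid.truncate (Matroid.freeOn (F : Set α)) 6) h) \ I : Finset α) : Set α)).toNat ≤ hi + δ then
          (((M.disjointSum (Matroid.truncate (Matroid.freeOn (F : Set α)) 6) h).eRk ((gr (M.disjointSum (Matroid.truncate (Matroid.freeOn (F : Set α)) 6) h) \ I : Finset α) : Set α)).toNat).choose δ else 0) := by
  haveI := PLDTruncate.freeOn_finite' F
  haveI := PLDClosure.disjointSum_finite' _ _ h
  have hU : (Matroid.truncate (Matroid.freeOn (F : Set α)) 6).eRank ≤ ((6 : ℕ) : ℕ∞) := by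
    rw [Matroid.truncate_eRank]; exact min_le_right _ _
  have hr' : M.eRank ≤ ((5 : ℕ) : ℕ∞) := by exact_mod_cast hr
  have hb : ∀ I ∈ (gr (M.disjointSum (Matroid.truncate (Matroid.freeOn (F : Set α)) 6) h)).powerset,
      ((M.disjointSum (Matroid.truncate (Matroid.freeOn (F : Set α)) 6) h).eRk (I : Set α)).toNat ≤ 11 ∧ ((M.disjointSum (Matroid.truncate (Matroid.freeOn (F : Set α)) 6) h).eRk ((gr (M.disjointSum (Matroid.truncate (Matroid.freeOn (F : Set α)) 6) h) \ I : Finset α) : Set α)).toNat ≤ 11 := by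
    intro I _
    constructor
    · rw [PLDClosure.toNat_eRk_disjointSum]
      have h1 := PLDCert.toNat_eRk_le_of_eRank_le M hr' ((I ∩ gr M : Finset α) : Set α)
      have h2 := PLDCert.toNat_eRk_le_of_eRank_le _ hU ((I ∩ gr (Matroid.truncate (Matroid.freeOn (F : Set α)) 6) : Finset α) : Set α)
      omega
    · rw [PLDClosure.toNat_eRk_disjointSum]
      have h1 := PLDCert.toNat_eRk_le_of_eRank_le M hr' (((gr (M.disjointSum (Matroid.truncate (Matroid.freeOn (F : Set α)) 6) h) \ I) ∩ gr M : Finset α) : Set α)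
      have h2 := PLDCert.toNat_eRk_le_of_eRank_le _ hU (((gr (M.disjointSum (Matroid.truncate (Matroid.freeOn (F : Set α)) 6) h) \ I) ∩ gr (Matroid.truncate (Matroid.freeOn (F : Set α)) 6) : Finset α) : Set α)
      omega
  refine PLDSymCex.pld_of_bounded (gr (M.disjointSum (Matroid.truncate (Matroid.freeOn (F : Set α)) 6) h)).powerset (fun I : Finset α => ((M.disjointSum (Matroid.truncate (Matroid.freeOn (F : Set α)) 6) h).eRk (I : Set α)).toNat)
    (fun I : Finset α => ((M.disjointSum (Matroid.truncate (Matroid.freeOn (F : Set α)) 6) h).eRk ((gr (M.disjointSum (Matroid.truncate (Matroid.freeOn (F : Set α)) 6) h) \ I : Finset α) : Set α)).toNat) 11 hb ?_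
  intro lo hi δ hlh hhR hδR
  have hL := PLDClosure.sum_powerset_disjointSum M _ h
    (fun x f => if lo ≤ x ∧ x ≤ hi ∧ (if lo = 0 then 0 else lo + hi + δ) ≤ f + x then f.choose δ else 0)
  have hR := PLDClosure.sum_powerset_disjointSum M _ h
    (fun x f => if lo + δ ≤ f ∧ f ≤ hi + δ then f.choose δ else 0)
  beta_reduce at hL hR
  rw [hL, hR]
  have h2L : ∀ x₁ f₁ : ℕ,
      ∑ I₂ ∈ (gr (Matroid.truncate (Matroid.freeOn (F : Set α)) 6)).powerset,
        (if lo ≤ x₁ + ((Matroid.truncate (Matroid.freeOn (F : Set α)) 6).eRk (I₂ : Set α)).toNat ∧ x₁ + ((Matroid.truncate (Matroid.freeOn (F : Set α)) 6).eRk (I₂ : Set α)).toNat ≤ hi ∧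
            (if lo = 0 then 0 else lo + hi + δ) ≤ f₁ + ((Matroid.truncate (Matroid.freeOn (F : Set α)) 6).eRk ((gr (Matroid.truncate (Matroid.freeOn (F : Set α)) 6) \ I₂ : Finset α) : Set α)).toNat +
              (x₁ + ((Matroid.truncate (Matroid.freeOn (F : Set α)) 6).eRk (I₂ : Set α)).toNat) then
          (f₁ + ((Matroid.truncate (Matroid.freeOn (F : Set α)) 6).eRk ((gr (Matroid.truncate (Matroid.freeOn (F : Set α)) 6) \ I₂ : Finset α) : Set α)).toNat).choose δ else 0) =
      (∑ i ∈ range (F.card + 1), Nat.choose F.card i * (if lo ≤ x₁ + min i 6 ∧ x₁ + min i 6 ≤ hi ∧ (if lo = 0 then 0 else lo + hi + δ) ≤ (f₁ + min (F.card - i) 6) + (x₁ + min i 6) then (f₁ + min (F.card - i) 6).choose δ else 0)) := by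
    intro x₁ f₁
    have := PLDTruncate.sum_powerset_truncate_freeOn F 6
      (fun x₂ f₂ => if lo ≤ x₁ + x₂ ∧ x₁ + x₂ ≤ hi ∧ (if lo = 0 then 0 else lo + hi + δ) ≤ f₁ + f₂ + (x₁ + x₂) then
        (f₁ + f₂).choose δ else 0)
    beta_reduce at this
    exact this
  have h2R : ∀ f₁ : ℕ,
      ∑ I₂ ∈ (gr (Matroid.truncate (Matroid.freeOn (F : Set α)) 6)).powerset,
        (if lo + δ ≤ f₁ + ((Matroid.truncate (Matroid.freeOn (F : Set α)) 6).eRk ((gr (Matroid.truncate (Matroid.freeOn (F : Set α)) 6) \ I₂ : Finset α) : Set α)).toNat ∧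
            f₁ + ((Matroid.truncate (Matroid.freeOn (F : Set α)) 6).eRk ((gr (Matroid.truncate (Matroid.freeOn (F : Set α)) 6) \ I₂ : Finset α) : Set α)).toNat ≤ hi + δ then
          (f₁ + ((Matroid.truncate (Matroid.freeOn (F : Set α)) 6).eRk ((gr (Matroid.truncate (Matroid.freeOn (F : Set α)) 6) \ I₂ : Finset α) : Set α)).toNat).choose δ else 0) =
      (∑ i ∈ range (F.card + 1), Nat.choose F.card i * (if lo + δ ≤ f₁ + min (F.card - i) 6 ∧ f₁ + min (F.card - i) 6 ≤ hi + δ then (f₁ + min (F.card - i) 6).choose δ else 0)) := by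
    intro f₁
    have := PLDTruncate.sum_powerset_truncate_freeOn F 6
      (fun x₂ f₂ => if lo + δ ≤ f₁ + f₂ ∧ f₁ + f₂ ≤ hi + δ then (f₁ + f₂).choose δ else 0)
    beta_reduce at this
    exact this
  simp only [h2L, h2R]
  -- the case `m = 11` from the landed table, in 3 δ-parts
  have h4 : ∑ I ∈ (gr M).powerset, (∑ i ∈ range (11 + 1), Nat.choose 11 i * (if lo ≤ (M.eRk (I : Set α)).toNat + min i 6 ∧ (M.eRk (I : Set α)).toNat + min i 6 ≤ hi ∧ (if lo = 0 then 0 else lo + hi + δ) ≤ ((M.eRk ((gr M \ I : Finset α) : Set α)).toNat + min (11 - i) 6) + ((M.eRk (I : Set α)).toNat + min i 6) then ((M.eRk ((gr M \ I : Finset α) : Set α)).toNat + min (11 - i) 6).choose δ else 0)) ≤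
      ∑ I ∈ (gr M).powerset, (∑ i ∈ range (11 + 1), Nat.choose 11 i * (if lo + δ ≤ (M.eRk ((gr M \ I : Finset α) : Set α)).toNat + min (11 - i) 6 ∧ (M.eRk ((gr M \ I : Finset α) : Set α)).toNat + min (11 - i) 6 ≤ hi + δ then ((M.eRk ((gr M \ I : Finset α) : Set α)).toNat + min (11 - i) 6).choose δ else 0)) := by
    rcases Nat.lt_or_ge δ 4 with hδ0 | hδ0
    · obtain ⟨hDpos, hadm, hcert⟩ := PLDTriangle.uniform_6_11_table_5_part0 _ rfl lo (mem_range.2 (by omega)) hi (mem_range.2 (by omega))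
        δ (mem_range.2 (by omega)) hlh
      have key := PLDCert.sum_le_of_cert M hPLD 5 hr' _ hadm _ _ hcert
      rw [← Finset.mul_sum, ← Finset.mul_sum] at key
      exact Nat.le_of_mul_le_mul_left key hDpos
    rcases Nat.lt_or_ge δ 8 with hδ1 | hδ1
    · obtain ⟨hDpos, hadm, hcert⟩ := PLDTriangle.uniform_6_11_table_5_part1 _ rfl lo (mem_range.2 (by omega)) hi (mem_range.2 (by omega))
        δ (mem_Ico.2 ⟨by omega, by omega⟩) hlh
      have key := PLDCert.sum_le_of_cert M hPLD 5 hr' _ hadm _ _ hcert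
      rw [← Finset.mul_sum, ← Finset.mul_sum] at key
      exact Nat.le_of_mul_le_mul_left key hDpos
    obtain ⟨hDpos, hadm, hcert⟩ := PLDTriangle.uniform_6_11_table_5_part2 _ rfl lo (mem_range.2 (by omega)) hi (mem_range.2 (by omega))
      δ (mem_Ico.2 ⟨by omega, by omega⟩) hlh
    have key := PLDCert.sum_le_of_cert M hPLD 5 hr' _ hadm _ _ hcert
    rw [← Finset.mul_sum, ← Finset.mul_sum] at key
    exact Nat.le_of_mul_le_mul_left key hDpos
  -- the lift to `m = |F| ≥ 11`
  have hq := PLDPlaneTable.pld_conv_q61_of_eRank_le_5 M hr hPLD lo hi δ hlh hhR hδR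
  have hq' := PLDPlaneTable.pld_conv_q62_of_eRank_le_5 M hr hPLD lo hi δ hlh hhR hδR
  have hq'' := PLDPlaneTable.pld_conv_q63_of_eRank_le_5 M hr hPLD lo hi δ hlh hhR hδR
  have hq''' := PLDPlaneTable.pld_conv_q64_of_eRank_le_5 M hr hPLD lo hi δ hlh hhR hδR
  exact lift_instance_six_three (gr M).powerset (fun I : Finset α => (M.eRk (I : Set α)).toNat)
    (fun I : Finset α => (M.eRk ((gr M \ I : Finset α) : Set α)).toNat) hPLD F.card hF lo hi δ
    (if lo = 0 then 0 else lo + hi + δ) (by split_ifs <;> omega) (by split_ifs <;> omega)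
    (by simpa only [mul_add, add_assoc, one_mul] using hq) (by simpa only [mul_add, add_assoc, one_mul] using hq')
    (by simpa only [mul_add, add_assoc, one_mul] using hq'') (by simpa only [mul_add, add_assoc, one_mul] using hq''') h4

end PLDSixLift

end PercRepro
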